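import Mathlib
import HarnessLib
import Summits.NavierStokesRegularity.NavierStokesRegularity.Theorems.CompletionRelayChainPhaseISoundRun
import Summits.NavierStokesRegularity.NavierStokesRegularity.Theorems.CompletionRelayChainRelayFrontStepIdle

/-!
# Route `CompletionRelayChain` — crux `RelayFrontStep` (stmt-NavierStokesRegularity-24850), K-side of `stub_phaseI`,
  work package K5-i: START CONTAINMENT (`nodeInv_start`) and FOOTER READ-OUT lemmas

MODEL-lattice bookkeeping (rung TL-M3-R64); nothing here is a statement about the Navier–Stokes equations.
-/

noncomputable section

set_option linter.dupNamespace false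

namespace Summit.NavierStokesRegularity.NavierStokesRegularity.Cruxes.RelayFrontStep.PhaseI

open Set Checker MeasureTheory
open Literature.Analysis.FluidPDE.TaoCascade

attribute [local irreducible] Checker.step Checker.boxGuess Checker.bSearch

variable {α : Fin 4 → Fin 4 → Fin 4 → ℤ × ℤ × ℤ → ℝ} {τ : ℝ} {S₀ F₀ B₀ : Fin 4 → ℤ → ℝ} {S F : Fin 4 → ℤ → ℝ → ℝ}

/-! ### Small facts -/

/-- The extended block curve at the wake components of old shells `−3, −2`. [this file] -/
theorem zc_table2 (S : Fin 4 → ℤ → ℝ → ℝ) (t : ℝ) :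
    zc S t (cix 0 0) = S 0 (-3) t ∧ zc S t (cix 0 1) = S 1 (-3) t ∧ zc S t (cix 0 2) = S 2 (-3) t ∧
    zc S t (cix 1 0) = S 0 (-2) t ∧ zc S t (cix 1 1) = S 1 (-2) t ∧ zc S t (cix 1 2) = S 2 (-2) t :=
  ⟨rfl, rfl, rfl, rfl, rfl, rfl⟩

/-- `|S i k 0| ≤ b` from a shell-energy bound `Σ_j F₀ j k ≤ b²/2`. [this file] -/
theorem abs_start_le (H : Hyps α τ S₀ F₀ B₀ S F) (i : Fin 4) (k : ℤ) {b : ℝ} (hb : 0 ≤ b)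
    (hE : ∑ j, F₀ j k ≤ b ^ 2 / 2) : |S i k 0| ≤ b := by
  have hτ0 : (0:ℝ) ∈ Icc (0:ℝ) τ := ⟨le_rfl, le_trans (by norm_num) H.hτ⟩
  have h1 := sq_le_two_sum H i k hτ0
  have h2 : ∑ j, F j k 0 = ∑ j, F₀ j k := Finset.sum_congr rfl fun j _ => H.hflow.init_F j k
  rw [h2] at h1
  have h3 : S i k 0 ^ 2 ≤ b ^ 2 := by linarith
  exact abs_le_of_sq_le_sq h3 hb

/-- `|S i 2 0| ≤ 5·10^{-10}` for the active modes. [this file] -/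
theorem abs_start_shell2 (H : Hyps α τ S₀ F₀ B₀ S F) (i : Fin 4) (hi : i ≠ 3) : |S i 2 0| ≤ 5 / 10 ^ 10 := by
  have hτ0 : (0:ℝ) ∈ Icc (0:ℝ) τ := ⟨le_rfl, le_trans (by norm_num) H.hτ⟩
  have h1 := H.hflow.defect_lower i 2 0 hτ0
  rw [H.hflow.init_F] at h1
  have h2 := H.hW.2.2.2.2.2.2.2.2.2.2.1 2 le_rfl i hi
  rw [aheadE_two] at h2
  simp only [aheadE2] at h2; push_cast at h2
  have h3 : S i 2 0 ^ 2 ≤ (5 / 10 ^ 10) ^ 2 := by nlinarith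
  exact abs_le_of_sq_le_sq h3 (by norm_num)

/-- `wakeS (-1) = 1/4`, `wakeS (-2) = 1/2`, `wakeS (-3) = 1`. [this file] -/
theorem wakeS_vals : Window2.wakeS (-1) = 1 / 4 ∧ Window2.wakeS (-2) = 1 / 2 ∧ Window2.wakeS (-3) = 1 := by
  simp only [Window2.wakeS]
  refine ⟨?_, ?_, ?_⟩
  · rw [show (-((-1 : ℤ) : ℝ)) = ((1 : ℕ) : ℝ) by norm_num, Real.rpow_natCast]; norm_num
  · rw [show (-((-2 : ℤ) : ℝ)) = ((2 : ℕ) : ℝ) by norm_num, Real.rpow_natCast]; norm_num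
  · rw [show (-((-3 : ℤ) : ℝ)) = ((3 : ℕ) : ℝ) by norm_num, Real.rpow_natCast]; norm_num

/-- A point of `[lo, hi]` is contained in `const ((lo+hi)/2) ((hi-lo)/2)`. [this file] -/
theorem contains_const_of_mem {θ : Fin 7 → ℝ} {x : ℝ} {lo hi : ℚ} (h1 : (lo : ℝ) ≤ x) (h2 : x ≤ hi) :
    (TM.const ((lo + hi) / 2) ((hi - lo) / 2) : TM 7).Contains θ x := by
  refine TM.contains_const ?_
  push_cast
  rw [abs_le]; constructor <;> linarith

/-! ### Start containment -/

/-- Midpoint of a parameter interval. [this file] -/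
def pmid (cell : Cell) (j : Fin 7) : ℚ := (cell.plo j + cell.phi j) / 2
/-- Radius of a parameter interval. [this file] -/
def prad (cell : Cell) (j : Fin 7) : ℚ := (cell.phi j - cell.plo j) / 2

/-- Evaluation of the start model of a parameter component. [this file] -/
theorem evalR_startParam (cell : Cell) (j : Fin 7) (θ : Fin 7 → ℝ) :
    (⟨(cell.plo j + cell.phi j) / 2, fun i => if i = j then (cell.phi j - cell.plo j) / 2 else 0, fun _ _ => 0, 0⟩ :
      TM 7).evalR θ = (pmid cell j : ℝ) + (prad cell j : ℝ) * θ j := by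
  simp only [TM.evalR, pmid, prad]
  have h1 : ∑ i : Fin 7, (((if i = j then (cell.phi j - cell.plo j) / 2 else 0 : ℚ)) : ℝ) * θ i =
      (((cell.phi j - cell.plo j) / 2 : ℚ) : ℝ) * θ j := by
    rw [Finset.sum_eq_single j]
    · simp
    · intro i _ hij; simp [hij]
    · intro h; exact absurd (Finset.mem_univ j) h
  rw [h1]
  simp

/-- `paramOf c = some j` forces `paramComp j = c`. [this file] -/
theorem paramComp_of_paramOf {c : Fin 19} {j : Fin 7} (h : paramOf c = some j) : paramComp j = c := by
  unfold paramOf at h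
  have := List.find?_some h
  exact of_decide_eq_true this

/-- One fixed component: from the value and the interval. [this file] -/
theorem fixed_case {S : Fin 4 → ℤ → ℝ → ℝ} {c : Fin 19} {x : ℝ} {lo hi : ℚ} (hz : zc S 0 c = x)
    (hF : fixedIV c = ⟨lo, hi⟩) (h : ((lo : ℚ) : ℝ) ≤ x ∧ x ≤ ((hi : ℚ) : ℝ)) :
    (((fixedIV c).lo : ℚ) : ℝ) ≤ zc S 0 c ∧ zc S 0 c ≤ (((fixedIV c).hi : ℚ) : ℝ) := by
  rw [hF, hz]; exact h

/-- The start values of the fixed (non-parameter) components lie in `fixedIV`. [this file] -/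
theorem fixed_start (H : Hyps α τ S₀ F₀ B₀ S F) (c : Fin 19) (hpo : paramOf c = none) :
    (((fixedIV c).lo : ℚ) : ℝ) ≤ zc S 0 c ∧ zc S 0 c ≤ (((fixedIV c).hi : ℚ) : ℝ) := by
  obtain ⟨w1, w2, _, _, _, _, _, _, w9, w10, _, wwake, _⟩ := H.hW
  obtain ⟨z30, z31, _, _, _, z42, z50, z51, z52, _, _, _⟩ := zc_table S 0
  obtain ⟨z00, z01, z02, z10, _, z12⟩ := zc_table2 S 0
  have hi := H.hflow.init_S
  obtain ⟨_, wk2, wk3⟩ := wakeS_vals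
  have hwm2 := wwake (-2) (by norm_num); have hwm3 := wwake (-3) (by norm_num)
  rw [wk2] at hwm2; rw [wk3] at hwm3
  have hm3 : ∀ i : Fin 4, |S i (-3) 0| ≤ ((rtTwo : ℚ) : ℝ) := fun i =>
    abs_start_le H i (-3) (by norm_num [rtTwo]) (by simp only [rtTwo]; push_cast; linarith)
  have hm2 : ∀ i : Fin 4, |S i (-2) 0| ≤ 1 := fun i => abs_start_le H i (-2) (by norm_num) (by linarith)
  have hs2 := abs_start_shell2 H
  have c3 : ∀ i : Fin 4, ((-rtTwo : ℚ) : ℝ) ≤ S i (-3) 0 ∧ S i (-3) 0 ≤ ((rtTwo : ℚ) : ℝ) := fun i => by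
    have := abs_le.1 (hm3 i); push_cast; exact this
  have c2 : ∀ i : Fin 4, (((-1 : ℚ)) : ℝ) ≤ S i (-2) 0 ∧ S i (-2) 0 ≤ ((1 : ℚ) : ℝ) := fun i => by
    have := abs_le.1 (hm2 i); push_cast; exact this
  have c5 : ∀ i : Fin 4, i ≠ 3 → ((-(5 / 10 ^ 10) : ℚ) : ℝ) ≤ S i 2 0 ∧ S i 2 0 ≤ ((5 / 10 ^ 10 : ℚ) : ℝ) :=
    fun i hi3 => by have := abs_le.1 (hs2 i hi3); push_cast; exact this
  fin_cases c
  · exact fixed_case z00 rfl (c3 0)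
  · exact fixed_case z01 rfl (c3 1)
  · exact fixed_case z02 rfl (c3 2)
  · exact fixed_case z10 rfl (c2 0)
  · exact absurd hpo (by decide)
  · exact fixed_case z12 rfl (c2 2)
  · exact absurd hpo (by decide)
  · exact absurd hpo (by decide)
  · exact absurd hpo (by decide)
  · exact fixed_case z30 rfl (by rw [hi, w1]; push_cast; exact ⟨le_rfl, le_rfl⟩)
  · exact fixed_case z31 rfl (by rw [hi, w2]; push_cast; exact ⟨le_rfl, le_rfl⟩)
  · exact absurd hpo (by decide)
  · exact absurd hpo (by decide)
  · exact absurd hpo (by decide)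
  · exact fixed_case z42 rfl (by rw [hi]; push_cast; exact ⟨by linarith, by linarith⟩)
  · exact fixed_case z50 rfl (c5 0 (by decide))
  · exact fixed_case z51 rfl (c5 1 (by decide))
  · exact fixed_case z52 rfl (c5 2 (by decide))
  · exact fixed_case (zc_last S 0) rfl (by push_cast; exact ⟨le_rfl, le_rfl⟩)

/-- **The node invariant at node `0`** for a cell whose parameter box contains the start values (midpoint form).
[this file] -/
theorem nodeInv_start (H : Hyps α τ S₀ F₀ B₀ S F) {cell : Cell} {θ : Fin 7 → ℝ}
    (hθ : ∀ j, zc S 0 (paramComp j) = (pmid cell j : ℝ) + (prad cell j : ℝ) * θ j) :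
    NodeInv S F θ 0 (startState cell) := by
  have h0 : ((0 : ℕ) : ℝ) * hR = 0 := by simp
  refine ⟨fun c => ?_, ?_, ?_, fun h => absurd h (lt_irrefl 0), fun h => absurd h (lt_irrefl 0)⟩
  · rw [h0]
    have hTc : (startState cell).T[c] = startTMc cell c := by
      simp only [startState, Fin.getElem_fin, Vector.getElem_ofFn]
    rw [hTc]
    unfold startTMc
    cases hpo : paramOf c with
    | some j =>
      have hc := paramComp_of_paramOf hpo
      subst hc
      simp only
      unfold TM.Contains
      rw [evalR_startParam, hθ j]
      simp
    | none =>
      simp only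
      obtain ⟨h1, h2⟩ := fixed_start H c hpo
      exact contains_const_of_mem h1 h2
  all_goals rw [h0]; simp [startState, intervalIntegral.integral_same]

/-! ### Footer read-out: shell energies -/

/-- `Σ_{i<3} ∫₀ᵗ F_{i,k} ≤ (5/2)·t` on `[0,8]` for block shells. [this file] -/
theorem integral_F3_le (H : Hyps α τ S₀ F₀ B₀ S F) {k : ℤ} (hk : -3 ≤ k) {t : ℝ} (ht0 : 0 ≤ t) (ht8 : t ≤ 8) :
    (∫ u in (0:ℝ)..t, F 0 k u) + (∫ u in (0:ℝ)..t, F 1 k u) + (∫ u in (0:ℝ)..t, F 2 k u) ≤ 5 / 2 * t := by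
  have htτ : t ≤ τ := ht8.trans H.hτ
  have hc : ∀ i, ContinuousOn (F i k) (Icc 0 t) := fun i =>
    ((H.hflow.contDiffOn_F i k).continuousOn).mono (Icc_subset_Icc_right htτ)
  have hii : ∀ i, IntervalIntegrable (F i k) volume 0 t := fun i => (hc i).intervalIntegrable_of_Icc ht0
  rw [← intervalIntegral.integral_add (hii 0) (hii 1), ← intervalIntegral.integral_add ((hii 0).add (hii 1)) (hii 2)]
  have hle : ∀ u ∈ Icc (0:ℝ) t, F 0 k u + F 1 k u + F 2 k u ≤ 5 / 2 := by
    intro u hu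
    have huτ : u ∈ Icc (0:ℝ) τ := ⟨hu.1, hu.2.trans htτ⟩
    have h := H.hA u huτ (hu.2.trans ht8) k hk
    rw [Fin.sum_univ_four] at h
    linarith [H.hflow.nonneg_F 3 k u huτ]
  calc (∫ u in (0:ℝ)..t, F 0 k u + F 1 k u + F 2 k u) ≤ ∫ _ in (0:ℝ)..t, (5 / 2 : ℝ) := by
        refine intervalIntegral.integral_mono_on ht0 (((hii 0).add (hii 1)).add (hii 2)) (by simp) fun u hu => hle u hu
    _ = 5 / 2 * t := by simp; ring

/-- `idleE k` for `k = 0, 1, 2` equals the checker's `idleEQ`. [this file] -/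
theorem idleE_vals : Window2.idleE 0 = ((idleEQ 3 : ℚ) : ℝ) ∧ Window2.idleE 1 = ((idleEQ 4 : ℚ) : ℝ) ∧
    Window2.idleE 2 = ((idleEQ 5 : ℚ) : ℝ) := by
  simp only [Window2.idleE, idleEQ]
  refine ⟨?_, ?_, ?_⟩
  · norm_num
  · norm_num [Real.rpow_neg_one]
  · norm_num

/-- **Shell energy from the footer quantity**: `Σ_i F i k t ≤ energyHi` when the node models contain the block at
time `t ≤ T*` (`k = s − 3`, `s = 3,4,5`). [this file] -/
theorem sum_F_le_energyHi (H : Hyps α τ S₀ F₀ B₀ S F) {θ : Fin 7 → ℝ} (hθ : TM.InBox θ) {T : V19 (TM 7)} {t : ℝ}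
    (ht0 : 0 ≤ t) (htT : t ≤ 147 / 64) (hT : ∀ c : Fin 19, TM.Contains (T[c]) θ (zc S t c))
    (s : ℕ) (hs3 : 3 ≤ s) (hs6 : s < 6) :
    ∑ i, F i ((s : ℤ) - 3) t ≤ ((energyHi T s : ℚ) : ℝ) := by
  have ht8 : t ≤ 8 := htT.trans (by norm_num)
  have htτ : t ∈ Icc (0:ℝ) τ := ⟨ht0, ht8.trans H.hτ⟩
  set k : ℤ := (s : ℤ) - 3 with hk
  have hk3 : -3 ≤ k := by omega
  have hsF : (⟨s, hs6⟩ : Fin 6) = ⟨s, hs6⟩ := rfl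
  have hcix : ∀ (i : ℕ) (hi : i < 3), cix s i = enc (⟨s, hs6⟩, ⟨i, hi⟩) := fun i hi => by
    apply Fin.ext; simp [cix, enc]; omega
  -- amplitudes in the TM of ½ΣS²
  have hsq : ∀ (i : ℕ) (hi : i < 3), TM.Contains ((T[cix s i]).sq) θ (S (blockMode ⟨i, hi⟩) k t * S (blockMode ⟨i, hi⟩) k t) := by
    intro i hi
    have h1 := hT (cix s i)
    rw [zc_cix S t hs6 hi] at h1
    exact TM.contains_sq hθ h1
  have hsum := TM.le_hi2 _ hθ (TM.contains_add (TM.contains_add (hsq 0 (by norm_num)) (hsq 1 (by norm_num)))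
    (hsq 2 (by norm_num)))
  -- energies
  have hfe : (1 + 1 : ℝ) ^ ((2 : ℝ) * (k : ℝ)) = ((fourPow (cix s 0) : ℚ) : ℝ) := by
    rw [hcix 0 (by norm_num)]
    have := rpow_two_mul_eq_fourPow (⟨s, hs6⟩ : Fin 6) ⟨0, by norm_num⟩
    simpa [hk] using this
  have hdu : ∀ (i : ℕ) (hi : i < 3), F (blockMode ⟨i, hi⟩) k t ≤ (1/2) * S (blockMode ⟨i, hi⟩) k t ^ 2 +
      B₀ (blockMode ⟨i, hi⟩) k + (1 / 10 ^ 8) * ((fourPow (cix s 0) : ℚ) : ℝ) * ∫ u in (0:ℝ)..t, F (blockMode ⟨i, hi⟩) k u := by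
    intro i hi
    have h := H.hflow.defect_upper (blockMode ⟨i, hi⟩) k t htτ
    rw [hfe] at h; exact h
  have hb0 : ∀ (i : ℕ) (hi : i < 3), B₀ (blockMode ⟨i, hi⟩) k ≤ ((b0max (cix s 0) : ℚ) : ℝ) := by
    intro i hi
    have h := b0_le_b0max H ⟨s, hs6⟩ ⟨i, hi⟩
    have e : b0max (cix s 0) = b0max (enc ((⟨s, hs6⟩ : Fin 6), (⟨i, hi⟩ : Fin 3))) := by
      have h1 : slot (cix s 0) = s := by simp [slot, cix]; omega
      have h2 : slot (enc ((⟨s, hs6⟩ : Fin 6), (⟨i, hi⟩ : Fin 3))) = s := slot_enc _ _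
      simp only [b0max, h1, h2]
    rw [e]; simpa [hk] using h
  have hint := integral_F3_le H hk3 ht0 ht8
  have hidle : F 3 k t ≤ ((idleEQ s : ℚ) : ℝ) := by
    have h1 := Summit.NavierStokesRegularity.NavierStokesRegularity.Theorems.RelayFrontStep.idle_energy_le_init
      H.hflow (by linarith [H.hτ]) 3 H.hrows.2.2.2 k htτ
    have h2 := H.hW.2.2.2.2.2.2.2.2.2.2.2.2 k
    obtain ⟨e0, e1, e2⟩ := idleE_vals
    interval_cases s
    · have hk0 : k = 0 := by omega
      rw [hk0] at h1 h2 ⊢; rw [e0] at h2; exact h1.trans h2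
    · have hk1 : k = 1 := by omega
      rw [hk1] at h1 h2 ⊢; rw [e1] at h2; exact h1.trans h2
    · have hk2 : k = 2 := by omega
      rw [hk2] at h1 h2 ⊢; rw [e2] at h2; exact h1.trans h2
  have hfp : (0:ℝ) ≤ ((fourPow (cix s 0) : ℚ) : ℝ) := by rw [fourPow]; push_cast; positivity
  rw [Fin.sum_univ_four]
  simp only [energyHi, shellEnergyHi, Checker.kappa, Checker.Tstar]
  push_cast
  have h0 := hdu 0 (by norm_num); have h1 := hdu 1 (by norm_num); have h2 := hdu 2 (by norm_num)
  have g0 := hb0 0 (by norm_num); have g1 := hb0 1 (by norm_num); have g2 := hb0 2 (by norm_num)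
  simp only [blockMode, Matrix.cons_val_zero, Matrix.cons_val_one, Fin.mk_zero, Fin.mk_one] at h0 h1 h2 g0 g1 g2 hsum
  have e2 : (⟨2, by norm_num⟩ : Fin 3) = 2 := rfl
  simp only [e2, Matrix.cons_val_two, Matrix.tail_cons, Matrix.head_cons] at h2 g2 hsum
  set II : ℝ := (∫ u in (0:ℝ)..t, F 0 k u) + (∫ u in (0:ℝ)..t, F 1 k u) + (∫ u in (0:ℝ)..t, F 2 k u) with hII
  have hI : (1 / 10 ^ 8 : ℝ) * ((fourPow (cix s 0) : ℚ) : ℝ) * II ≤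
      (1 / 10 ^ 8 : ℝ) * ((fourPow (cix s 0) : ℚ) : ℝ) * (147 / 64 * (5 / 2)) := by
    refine mul_le_mul_of_nonneg_left ?_ (by positivity)
    nlinarith
  have hsq0 : S 0 k t ^ 2 = S 0 k t * S 0 k t := sq _
  have hsq1 : S 1 k t ^ 2 = S 1 k t * S 1 k t := sq _
  have hsq2 : S 2 k t ^ 2 = S 2 k t * S 2 k t := sq _
  rw [hsq0] at h0; rw [hsq1] at h1; rw [hsq2] at h2
  have eII : (1 / 10 ^ 8 : ℝ) * ((fourPow (cix s 0) : ℚ) : ℝ) * II =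
      (1 / 10 ^ 8 : ℝ) * ((fourPow (cix s 0) : ℚ) : ℝ) * (∫ u in (0:ℝ)..t, F 0 k u) +
      (1 / 10 ^ 8 : ℝ) * ((fourPow (cix s 0) : ℚ) : ℝ) * (∫ u in (0:ℝ)..t, F 1 k u) +
      (1 / 10 ^ 8 : ℝ) * ((fourPow (cix s 0) : ℚ) : ℝ) * (∫ u in (0:ℝ)..t, F 2 k u) := by rw [hII]; ring
  linarith

end Summit.NavierStokesRegularity.NavierStokesRegularity.Cruxes.RelayFrontStep.PhaseI

end
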